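import Summits.AtomisticToContinuum.BoseEinsteinCondensation.Theses.BECInsertionCorrector
import Summits.AtomisticToContinuum.BoseEinsteinCondensation.Theorems.StaticResponseBound.Negative.Basic
import Summits.AtomisticToContinuum.BoseEinsteinCondensation.Theorems.BECInsertionCorrectorStaticResponseBoundFreeSquare
import Summits.AtomisticToContinuum.BoseEinsteinCondensation.Theorems.BECInsertionCorrectorStaticResponseBoundThomsonReduction
import Summits.AtomisticToContinuum.BoseEinsteinCondensation.Theorems.BECInsertionCorrectorStaticResponseBoundModulationBootstrapOfExists
import Summits.AtomisticToContinuum.BoseEinsteinCondensation.Theorems.BECInsertionCorrectorStaticResponseBoundTruncationCompactness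
import Literature.MathematicalPhysics.QuantumManyBody.PeriodicFormDomain
import Literature.MathematicalPhysics.QuantumManyBody.WeightedCorrector
import Literature.MathematicalPhysics.QuantumManyBody.PeriodicBoseGasScatteringODE

/-!
# Line `uv-thomson-force-wave` — skeleton for the crux `BECInsertionCorrector.StaticResponseBound`
(crux item stmt-AtomisticToContinuum-12057, rank 2 of route `route-AtomisticToContinuum-BECInsertionCorrector`,
rank 3 of `route-AtomisticToContinuum-BECBathMassLiouville`; the two decls agree verbatim,
`Negative.staticResponseBound_routes_agree`)

Crux (FIXED, by name): `StaticResponseBound` — for every repulsive finite-range `v` there are `ρ₀ > 0`, `C > 0`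
with `E₀^per(N,L) − C t² N / max(ρa, |p|²) ≤ ⟨Ψ, (H_N + t ∑ⱼ cos(p·xⱼ)) Ψ⟩` for all `0 < ρ < ρ₀`, ALL `N`, all
`k ∈ ℤ³∖0` (`p = 2πk/L`, `L = (N/ρ)^{1/3}`), all `t ∈ ℝ` and all finite-energy periodic trial states `Ψ`
(discriminant form: `⟨∑cos⟩_Ψ² ≤ 4CN(E_Ψ − E₀)/max(ρa,p²)`, `Negative.forall_ineq_iff_discriminant`).

Idea (card `Ideas/uv-thomson-force-wave.md`, triage r1-1/2/3: pass): THOMSON'S (dual Dirichlet / minimal-flow)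
PRINCIPLE for the Kipnis–Varadhan `H₋₁` norm of the density wave `V_p = ∑ⱼ cos(p·xⱼ)` under a ground-state
weight `|Φ|²`: with the free displacement flow `Yⱼ = sin(p·xⱼ) p̂` one integration by parts on the torus gives the
exact identity `|p| V_p |Φ|² = −∇·(Y|Φ|²) − Q_Φ |Φ|²`, `Q_Φ := Y·∇log|Φ|² = ∑ⱼ sin(p·xⱼ) p̂·∇ⱼ|Φ|²/|Φ|²`
(the FORCE-DENSITY WAVE), whence `|p| ‖V_p − V̄‖₋₁ ≤ ‖Y‖_{L²(|Φ|²)} + ‖Q_Φ − Q̄‖₋₁ ≤ √N + ‖Q_Φ − Q̄‖₋₁`: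
on the ultraviolet window `|p|² ≥ Λρa` the crux's constant `N/p²` IS the energy of the free flow, and the UV half
of the crux reduces to ONE statement, an `H₋₁` bound `‖Q_Φ − Q̄‖²₋₁ ≤ K·N` on the force wave.

THE LINE — skeleton v3 (lead reshape 2, 2026-08-16). Registered stubs are `theorem stub_x : <statement
written out in tree vocabulary> := by sorry`; the `def`s `InfraredHalf … FreeSquare` below are definitionally
equal abbreviations used by the glue `kineticBranch_of` / `body_of_stubs` (kernel-checked, axiom-clean);
`StaticResponseBound_of : StaticResponseBound` concludes the crux BY NAME.
STATUS after the opening lead session (all landed files are `Theorems/BECInsertionCorrectorStaticResponseBound*.lean`,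
namespace `…Cruxes.StaticResponseBound.UvThomsonForceWave`, attached `--supports stmt-AtomisticToContinuum-12057`):
* S6 `stub_freeSquare` — CLOSED (p73757, `…FreeSquare.lean`): the free completed square, all `v, N, t`.
* S4 `stub_thomsonReduction` — CLOSED (p74247, `…ThomsonReduction.lean`): Thomson's principle for ANY periodic
  trial state (complex values, zeros allowed).
* S3 `ModulationBootstrap` — THEOREM MODULO the new stub `stub_modulatedMinimiserExists` (F1: existence of positive
  real `C¹` minimisers of `E_w + s⟨∑cos⟩`, bounded `w`), by the landed Kato-free bridge
  `stub_modulationBootstrap_of_exists` (`…ModulationRealForm/EulerLagrange/TwoPoint/Toolkit/BootstrapOfExists.lean`: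
  weak Euler–Lagrange from minimality, ground-state representation, exact two-point identity
  `(s″−s)(V̄_Φ−V̄_Ψ) = 𝓔_Φ(|Ψ|/|Φ|)+𝓔_Ψ(|Φ|/|Ψ|)`, Kipnis–Varadhan at both couplings, one Poincaré constant at the
  base point, Dini lemma, half-wavelength translate for `V̄_0 = 0`).
* S2 `TruncationLimit` — THEOREM MODULO the new stub `stub_maxFormBound` (the Bose-symmetric periodic `C¹` core
  realises the maximal hard-core form infimum), by the landed reduction `truncationLimit_of_maxFormBound`
  (`…TruncationMonotone/TruncationCompactness.lean`: per-state Beppo Levi, compactness via the tree's Rellich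
  `PeriodicFormDomain.isCompactOperator_formEmbed`, Fatou).
* S1 `stub_infraredHalf` — OPEN, crux-sized: the IR half for every window `M₀` (= the sibling skeleton's
  `StaticResponseBoundPhonon`); audit/dictionary toolkit landed (`…InfraredWindow.lean`, p76060): on the window S1 ⟺
  the all-states compressibility bound `⟨∑cos⟩² ≤ 4C′N(E−E₀)/(ρa)`; every bounded-`N` fragment is vacuous at small `ρ`.
* S5 `stub_uvForceWaveBound` — OPEN, crux-sized (THE HEART): kernel-equivalent (`…UvSusceptibilityEquiv.lean`, p76206:
  `uvForceWaveBound_iff_uvSusceptibilityBound`, constants `(1+√K)²` both ways) to the N-uniform UV static-susceptibility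
  bound `hMinusOneSqW L |Φ| (∑ⱼcos(p·xⱼ) − cosMean) ≤ K N/|p|²` for the weakly modulated positive ground states of
  `v_n` on `Λρa ≤ |p|²` — the `t → 0` content of the crux's UV half at every weak coupling (no momentum-dependent
  susceptibility upper bound for the dilute Bose gas in the thermodynamic limit exists in print).
* glue: `kineticBranch_of : TruncationLimit → ModulationBootstrap → ThomsonReduction → UvForceWaveBound → FreeSquare →
  KineticBranch` (`M₀ = √Λ`, `C = (1+√K)² + 1`), `body_of_stubs` (`N = 0` by `Negative.ineq_N_zero`, split at `M₀²ρa`,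
  `ρ₀ = min`, `C = max`), `StaticResponseBound_of := staticResponseBound_iff.mpr (body_of_stubs stub_infraredHalf
  truncationLimit_holds modulationBootstrap_holds stub_thomsonReduction stub_uvForceWaveBound stub_freeSquare)`.
The planner's per-stub rationale is kept in the docstrings of `InfraredHalf` … `FreeSquare` below (the S2/S3 "why
true" paragraphs are now realised by the landed files, modulo F1 / MaxFormBound).

Disproof.lean (gen 2) honoured — §B (`k ≠ 0` load-bearing): used in S4 (division by `|p|²`), S6 (`cos(p·x)` is a
divergence only for `p ≠ 0`), S3 (`E′(0) = 0`); §E (finite-energy guard load-bearing): every energy statement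
(S1, S3, S6, the composition) carries `periodicEnergy _ Ψ ≠ ⊤`, and S2 transfers ENERGIES only; §C (tightness
`C ≥ 1/2`): the composition outputs `C ≥ C₁ + 1 ≥ 2`; §A (discriminant form = the all-states content): S3 is
exactly the statement that the `t → 0` content AT EVERY COUPLING `s` of the window gives the all-states form;
§G: `ineq_N_zero` imported, the large-`t` regime on the UV branch is the sharper free square S6; §H (Bochner junk
through arbitrary charges): no stub quantifies over arbitrary charge functions — the force wave is a concrete
continuous function built from `|Φ|²` and `pderiv`, and S4's hypothesis/conclusion are `hMinusOneSqW` statements;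
§F (no `(ρ₀, C)` uniform in `v`): constants are produced after `v` (S1, S5). No `_false_without_` theorem is
contradicted and no stub is an instance of a landed `Theorems/StaticResponseBound/Negative/*` lemma (imported:
`Negative.Basic`; its §B/§E variants delete hypotheses every stub keeps).
-/

noncomputable section

namespace Summit.AtomisticToContinuum.BoseEinsteinCondensation.Cruxes.StaticResponseBound.UvThomsonForceWave

open MeasureTheory Filter UnitAddTorus
open scoped ENNReal NNReal BigOperators Topology InnerProductSpace
open Literature.MathematicalPhysics.QuantumManyBody.BoseGas
open Summit.AtomisticToContinuum.BoseEinsteinCondensation.Theses.BECInsertionCorrector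
open Summit.AtomisticToContinuum.BoseEinsteinCondensation.Theorems.StaticResponseBound.Negative

set_option linter.unusedVariables false

-- The measure on `ℝ/ℤ` is the Haar PROBABILITY measure, as in `PeriodicFormDomain.lean` and in the landed
-- `Theorems/BECInsertionCorrectorStaticResponseBoundTruncationCompactness.lean` (stub `stub_maxFormBound`).
attribute [local instance] Literature.MathematicalPhysics.QuantumManyBody.BoseGas.formDomain_measureSpace
  Literature.MathematicalPhysics.QuantumManyBody.BoseGas.formDomain_isProbabilityMeasure
  Literature.MathematicalPhysics.QuantumManyBody.BoseGas.formDomain_isProbabilityMeasure_pi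

/-! ## The force-density wave -/

/-- The unit vector `p̂ = k/|k|` (components; junk `0` for `k = 0`, never used there). -/
def khat (k : Fin 3 → ℤ) (i : Fin 3) : ℝ :=
  (k i : ℝ) / Real.sqrt (∑ l, (k l : ℝ) ^ 2)

/-- **FORCE-DENSITY WAVE** of a periodic trial state `Φ` at lattice momentum `k` (`p = 2πk/L`):
`Q_Φ(X) = ∑ⱼ sin(p·xⱼ) p̂·∇ⱼ log|Φ|²(X) = (Y·∇|Φ|²)(X) / |Φ(X)|²`, `Yⱼ = sin(p·xⱼ) p̂` the free displacement
flow. Typed against the `C¹` function `|Φ|²` (triage r1-1/r1-2 sharpening: no division by `Φ`): the value is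
junk `0` where `Φ(X) = 0`, and the identity `Q_Φ |Φ|² = Y·∇|Φ|²` holds EVERYWHERE (at a zero of `|Φ|² ≥ 0`
its gradient vanishes), which is the only way `Q_Φ` enters (`∫ Q_Φ φ |Φ|²`). [card uv-thomson-force-wave] -/
def forceWave {N : ℕ} (L : ℝ) (k : Fin 3 → ℤ) (Φ : PeriodicTrialState N L) (X : Config N) : ℝ :=
  (∑ j : Fin N, Real.sin (2 * Real.pi / L * ∑ i, (k i : ℝ) * X j i) *
      ∑ i : Fin 3, khat k i * pderiv j i (fun Y => ‖Φ.ψ Y‖ ^ 2) X) / ‖Φ.ψ X‖ ^ 2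

/-! ## The six stub STATEMENTS (precise `Prop`s; the registered stubs are `theorem stub_x : X := by sorry`) -/

/-- **S1 `InfraredHalf`** — the INFRARED (phonon + crossover) HALF of the crux in its own currency, for
EVERY window parameter `M₀ > 0`: there are `ρ_IR > 0`, `C_IR > 0` such that the crux's inner inequality
`Negative.Ineq v C_IR ρ N k t Ψ` (`E₀^per − C_IR t² N/max(ρa,|p|²) ≤ ⟨Ψ,(H + t∑cos)Ψ⟩`) holds for
`0 < ρ < ρ_IR`, all `N ≥ 1`, all `k ≠ 0` with `|p|² ≤ M₀² ρa`, all `t`, all finite-energy `Ψ` — the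
compressibility-limited response of the phonon branch for ALL states (Bogoliubov: `N/(2(p²+16πρa))`).
This is VERBATIM the statement `StaticResponseBoundPhonon` (with `PhononBody` inlined) delivered by the
sibling line `Lines/stable-fraction-square-completion.lean` (its stubs A + B + C), whose own unclaimed stub D
`StaticResponseBoundKinetic` is in turn exactly what THIS line delivers (`kineticBranch_of` below): the two
skeletons interlock by name. NOT this idea's business (card: "Thomson's principle for the ultraviolet half");
alternatives: `fsum-sector-sandwich` bricks (9091 → `H₋₁`, `t → 0` only) composed with S2/S3 of this file,
or the IR partner `feynman-defect-screened-flux`. Why it might fail: a long-wavelength softening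
`m₋₁(p)·ρa/N → ∞` of the dilute gas (none known; Momoi 1996: `χ(q)` upper bounds are the open part of the
Pitaevskii–Stringari programme). Size XL (= the IR crux). -/
def InfraredHalf : Prop :=
  ∀ v : ℝ → ℝ≥0∞, IsRepulsiveFiniteRange v → ∀ M₀ : ℝ, 0 < M₀ →
    ∃ ρ₀ : ℝ, 0 < ρ₀ ∧ ∃ C : ℝ, 0 < C ∧
      ∀ ρ : ℝ, 0 < ρ → ρ < ρ₀ → ∀ N : ℕ, 0 < N → ∀ k : Fin 3 → ℤ, k ≠ 0 →
        psq (sideLength ρ N) k ≤ M₀ ^ 2 * (ρ * (scatteringLength v).toReal) →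
        ∀ t : ℝ, ∀ Ψ : PeriodicTrialState N (sideLength ρ N), periodicEnergy v Ψ ≠ ⊤ →
          Ineq v C ρ N k t Ψ

/-- **S2 `TruncationLimit`** — at FIXED `(N, L)` the periodic ground-state energies of the bounded
truncations `v_n = min(v, n)` (`truncPotential v n`, PeriodicBoseGasScatteringODE) converge up to that of
`v` whenever the latter is finite: `∀ ε > 0 ∃ n₁ ∀ n ≥ n₁, E₀^per(v,N,L) ≤ E₀^per(v_n,N,L) + ε` (the other
inequality is monotonicity, `periodicEnergy_truncPotential_le`). Why true: near-minimisers `Ψ_n` of `v_n`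
are bounded in `H¹` of the torus and converge (Rellich) to `Ψ ∈ H¹` with `∫|∇Ψ|² + ∫v_m|Ψ|² ≤ lim E₀(v_n)`
for every `m` (lower semicontinuity), hence `Ψ = 0` a.e. on the hard-core set and `E_v[Ψ] ≤ lim E₀(v_n)`
(monotone convergence); and `E₀^per(v)` — an infimum over `C¹` states — is `≤ E_v[Ψ]` by approximating `Ψ`
in the form norm by `C¹` periodic symmetric functions vanishing on the core set (the complement of the
tube set `⋃_{i<j}{|xᵢ−xⱼ|_𝕋 ≤ R}` is locally Lipschitz — transversal intersections — so
`H¹ ∩ {u = 0 on K} = H₀¹(Kᶜ)`; Hedberg's synthesis theorem in general; trivial for bounded `v`). Size M–L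
(B. Simon, J. Funct. Anal. 28 (1978) 377 — monotone convergence of forms; Adams–Hedberg Thm 9.1.3).
Used ONLY to transfer energies (never states) from `v_n` to `v`; `N = 0` is trivial. -/
def TruncationLimit : Prop :=
  ∀ v : ℝ → ℝ≥0∞, IsRepulsiveFiniteRange v → ∀ (N : ℕ) (L : ℝ), 0 < L →
    periodicGroundStateEnergy v N L ≠ ⊤ →
    ∀ ε : ℝ, 0 < ε → ∃ n₁ : ℕ, ∀ n : ℕ, n₁ ≤ n →
      (periodicGroundStateEnergy v N L).toReal ≤
        (periodicGroundStateEnergy (truncPotential v n) N L).toReal + ε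

/-- **S3 `ModulationBootstrap`** — FIXED-VOLUME second-order perturbation theory, the bridge from the
`t → 0` (`H₋₁`) content to the all-`t`/all-states form of the crux (Disproof §A discriminant): let `w` be a
BOUNDED admissible potential, `N ≥ 1`, `L > 0`, `k ≠ 0`, `T₂, K ≥ 0`. Suppose that for every coupling
`s` with `s² ≤ T₂`, every positive real periodic trial state `Φ` of finite energy MINIMISING the modulated
functional `Ψ ↦ E_w(Ψ) + s⟨∑ⱼcos(p·xⱼ)⟩_Ψ` over finite-energy states has centred static susceptibility
`‖V_p − ⟨V_p⟩_Φ‖²_{H₋₁(|Φ|²)} ≤ K` (`hMinusOneSqW` for the weight `|Φ|`). Then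
`E₀^per(w,N,L) − K t² ≤ E_w(Ψ) + t⟨∑cos⟩_Ψ` for every `t² ≤ T₂` and every finite-energy `Ψ`.
Why true (classical, everything at fixed `N, L`): `w` bounded of finite range ⇒ `W + sV_p ∈ L^∞`,
`H_s = ∑(−Δⱼ) + W + sV_p` on `L²((ℝ³/Lℤ³)^N)` has compact resolvent and a positivity-IMPROVING semigroup
(the configuration space is connected), so `E(s) = inf spec H_s` (= the infimum of the modulated functional
over the `C¹` core; bosonic = absolute) is a SIMPLE eigenvalue with a strictly positive eigenfunction,
`W^{2,p}` hence `C^{1,α}`: the minimiser of the hypothesis exists, is unique and is `Φ_s`; Kato–Rellich ⇒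
`E` real-analytic, `E′(s) = ⟨V_p⟩_{Φ_s}`, `E″(s) = −2⟨gΦ_s,(H_s−E(s))⁻¹gΦ_s⟩`, `g = V_p − ⟨V_p⟩_{Φ_s}`,
and the reduced-resolvent form equals `sup_φ{2∫gφΦ_s² − ∫|∇φ|²Φ_s²} = hMinusOneSqW` by the ground-state
representation `⟨φΦ_s,(H_s−E)φΦ_s⟩ = ∫|∇φ|²Φ_s²` and density of the `C¹` periodic core in the weighted
`H¹` (`Φ_s` continuous, positive); `E′(0) = 0` since `Φ_0` is translation invariant and `k ≠ 0` (Disproof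
§B); Taylor `E(t) = E(0) + ∫₀ᵗ(t−s)E″(s)ds ≥ E₀ − Kt²`, and `E(t) ≤ E_w(Ψ) + t⟨∑cos⟩_Ψ`. Boundedness of
`w` is ESSENTIAL: hard cores disconnect the configuration space, uniqueness and `E ∈ C¹` can fail and a
concave kink of `E` breaks the Taylor step — the line reaches hard cores through S2, NOT by dropping this
hypothesis. Size L (Reed–Simon IV §XII.2, XIII.12; Kato VII §3; Davies 1989 §4.2; tree:
`GroundStateFeynmanKacPerronFrobenius` (Dirichlet box), `WeightedCorrector`, `LangevinGenerator`). -/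
def ModulationBootstrap : Prop :=
  ∀ w : ℝ → ℝ≥0∞, IsRepulsiveFiniteRange w → (∃ M : ℝ≥0∞, M ≠ ⊤ ∧ ∀ r, w r ≤ M) →
    ∀ (N : ℕ), 1 ≤ N → ∀ (L : ℝ), 0 < L → ∀ (k : Fin 3 → ℤ), k ≠ 0 →
    ∀ (T₂ K : ℝ), 0 ≤ T₂ → 0 ≤ K →
    (∀ s : ℝ, s ^ 2 ≤ T₂ → ∀ Φ : PeriodicTrialState N L,
      (∀ X, Φ.ψ X = (‖Φ.ψ X‖ : ℂ)) → (∀ X, Φ.ψ X ≠ 0) → periodicEnergy w Φ ≠ ⊤ →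
      (∀ Ψ : PeriodicTrialState N L, periodicEnergy w Ψ ≠ ⊤ →
        (periodicEnergy w Φ).toReal + s * cosMean L k Φ ≤ (periodicEnergy w Ψ).toReal + s * cosMean L k Ψ) →
      hMinusOneSqW L (fun X => ‖Φ.ψ X‖)
          (fun X => (∑ j, Real.cos (2 * Real.pi / L * ∑ i, (k i : ℝ) * X j i)) - cosMean L k Φ)
        ≤ ENNReal.ofReal K) →
    ∀ t : ℝ, t ^ 2 ≤ T₂ → ∀ Ψ : PeriodicTrialState N L, periodicEnergy w Ψ ≠ ⊤ →
      (periodicGroundStateEnergy w N L).toReal - K * t ^ 2 ≤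
        (periodicEnergy w Ψ).toReal + t * cosMean L k Ψ

/-- **S4 `ThomsonReduction`** — THE LEVER (Thomson / minimal-flow principle for the Kipnis–Varadhan `H₋₁`
norm with the free displacement flow), provable now: for `L > 0`, `k ≠ 0` and ANY periodic trial state `Φ`
(weight `|Φ|`, `∫_cell|Φ|² = 1`; complex values and zeros allowed), if the CENTRED force wave has
`‖Q_Φ − Q̄‖²_{H₋₁(|Φ|²)} ≤ B` then `‖V_p − V̄‖²_{H₋₁(|Φ|²)} ≤ (√N + √B)²/|p|²` (`V̄ = ⟨∑cos⟩_Φ = cosMean`,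
`Q̄ = ∫_cell Q_Φ|Φ|²`). Proof (S/M): for a periodic test `φ`, integration by parts on the cell (`φ|Φ|²` is
`C¹` periodic; `p̂·∇ⱼ sin(p·xⱼ) = |p|cos(p·xⱼ)`, `|p| = √psq`) gives
`√psq ∫V_pφ|Φ|² = −∑ⱼ∫sin(p·xⱼ)(p̂·∇ⱼφ)|Φ|² − ∫Q_Φφ|Φ|²` using `Q_Φ|Φ|² = Y·∇|Φ|²` pointwise; with
`φ ≡ 1`: `Q̄ = −√psq·V̄`; hence `√psq∫(V_p−V̄)φ|Φ|² = −∫(Y·∇φ)|Φ|² − ∫(Q_Φ−Q̄)φ|Φ|²`; Cauchy–Schwarz with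
`∑ⱼsin² ≤ N`, `(p̂·∇ⱼφ)² ≤ |∇ⱼφ|²`, `∫|Φ|² = 1` bounds the first term by `√N√𝓔_Φ(φ)`, the criterion
`hMinusOneSqW_le_ofReal_iff` the second by `√B√𝓔_Φ(φ)`; square, criterion again. Consistency: `v = 0`,
`Φ` constant ⇒ `Q ≡ 0`, bound `N/|p|²` (`C = 1 ≥ 1/2`, Disproof §C). Leans on: `hMinusOneSqW_le_ofReal_iff`,
`dirichletFormW`, `gradDot`, `pderiv`, `IsPeriodicTest` (WeightedCorrector), `integral_cellN_pderiv_eq_zero`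
(LangevinGenerator), `Negative.integral_norm_sq_eq_one`, `integral_mul_le_Lp_mul_Lq`.
[KipnisLandim1999 App. 1 §6; Lyons–Peres, Probability on Trees and Networks, §2.4 (Thomson's principle)] -/
def ThomsonReduction : Prop :=
  ∀ (N : ℕ) (L : ℝ), 0 < L → ∀ (k : Fin 3 → ℤ), k ≠ 0 →
    ∀ (Φ : PeriodicTrialState N L) (B : ℝ), 0 ≤ B →
    hMinusOneSqW L (fun X => ‖Φ.ψ X‖)
        (fun X => forceWave L k Φ X - ∫ Y in cellN N L, forceWave L k Φ Y * ‖Φ.ψ Y‖ ^ 2)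
      ≤ ENNReal.ofReal B →
    hMinusOneSqW L (fun X => ‖Φ.ψ X‖)
        (fun X => (∑ j, Real.cos (2 * Real.pi / L * ∑ i, (k i : ℝ) * X j i)) - cosMean L k Φ)
      ≤ ENNReal.ofReal ((Real.sqrt N + Real.sqrt B) ^ 2 / psq L k)

/-- **S5 `UvForceWaveBound`** — THE HEART (hardest stub): for every admissible `v` there are a UV cut
`Λ ≥ 1`, a density threshold `ρ₁ > 0`, a constant `K ≥ 0` and a truncation height `n₀` such that for all
`n ≥ n₀`, `0 < ρ < ρ₁`, `N ≥ 1`, `k ≠ 0` in the UV WINDOW `Λρa(v) ≤ |p|²` (`L = (N/ρ)^{1/3}`, `p = 2πk/L`)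
and all WEAK modulations `s² ≤ |p|²·E₀^per(v_n,N,L)/N` (`|s| ≲ |p|√(4πρa)`: relative density modulation of
the ground state `≲ Λ^{-1/2}`; `N = 1` ⇒ `E₀ = 0` ⇒ `s = 0`, `Q ≡ 0`), every positive real finite-energy
periodic trial state `Φ` minimising `E_{v_n}(·) + s⟨∑cos⟩` (THE ground state of `H_{v_n} + sV_p`, unique by
Perron–Frobenius) has `‖Q_Φ − Q̄‖²_{H₋₁(|Φ|²)} ≤ K·N`. By S4 read both ways this is EQUIVALENT up to
constants to the susceptibility bound `‖V_p − V̄‖²_{H₋₁} ≤ K′N/p²` for the same family, i.e. to the `t → 0`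
content of the UV half at every weak coupling (triage r1-1/2/3: exact equivalence — the registered
obligation is that content in force-wave dress, nothing weaker). The card's BET on why the force-wave dress
is the provable one: `Q_Φ` is a sum of FORCES and forces in the dilute gas are (a) PAIR-LOCAL —
`∇ⱼlog J²`, `J = ∏f(xᵢ−xⱼ)` the zero-energy scattering (Jastrow) factor of range `b ≤ ξ = (ρa)^{-1/2}`,
antisymmetrised against `sin(p·xⱼ) − sin(p·xᵢ)` (small factor `p·r` for `|r| ≤ b ≪ 1/p`), to be bounded by
LOCAL coercivity of `𝓔_Φ` at scales `≤ ξ` where complete BEC / Bogoliubov ARE theorems (Fournais boxes);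
(b) HYDRODYNAMIC, `∝` the density wave with coefficient `λ_p = (S(p)⁻¹−1)|p| ≈ 8πρa/|p| ≪ |p|` on the window
(absorbable: the identity of S4 holds with `|p| + λ` for any `λ ≥ −|p|/2`); (c) a RESIDUAL `∇log(Φ/J)²`
(three-body + collective) that must be shown `H₋₁`-small — a `HigherCorrectorContraction`-type statement
at UV momenta, power counting IR- and UV-convergent in `d = 3`, no `log L`; (d) leakage of block
remainders into slow modes, controlled by S1-type input only. One-loop size of everything but the free term
(triage r1-1, `oneloop_purepy.out`; r1-3 j007275): `‖Q_rest‖²₋₁/N ≈ 0.34√(ρa³)` at `p² = 64πρa`,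
`16πJ2 = 0.011 … 0.061` for `p = 16/ξ … 0.25/ξ`. Why it might fail: (c) for the TRUE ground state;
`n`-uniformity at the hard-core contact (forces `∼ √n` inside the wall — but only `Q_Φ|Φ|² = Y·∇|Φ|²`,
uniformly integrable, ever enters; contact shells of width `η` contribute `O(η³)` to the `H₋₁` pairing).
Size XL. Leans on: `hMinusOneSqW`, `IsWeakCorrector`, `jastrow`/`pairFactor`/`IsPairProfile`
(PeriodicBoseGasJastrow), `scatteringProfile`/`truncPotential` (PeriodicBoseGasScatteringODE),
`Fournais2020_condensation`, `sectorPoincareConstant` (GroundStateDirichletForm), S1.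
[ReattoChester1967; Feynman1954; KipnisLandim1999 App. 1 §6; FournaisSolovej2020; BoccatoSeiringer2023] -/
def UvForceWaveBound : Prop :=
  ∀ v : ℝ → ℝ≥0∞, IsRepulsiveFiniteRange v →
    ∃ Λ : ℝ, 1 ≤ Λ ∧ ∃ ρ₁ : ℝ, 0 < ρ₁ ∧ ∃ K : ℝ, 0 ≤ K ∧ ∃ n₀ : ℕ, ∀ n : ℕ, n₀ ≤ n →
      ∀ ρ : ℝ, 0 < ρ → ρ < ρ₁ → ∀ N : ℕ, 1 ≤ N → ∀ k : Fin 3 → ℤ, k ≠ 0 →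
        Λ * (ρ * (scatteringLength v).toReal) ≤ psq (sideLength ρ N) k →
        ∀ s : ℝ, s ^ 2 ≤ psq (sideLength ρ N) k *
            (periodicGroundStateEnergy (truncPotential v n) N (sideLength ρ N)).toReal / N →
        ∀ Φ : PeriodicTrialState N (sideLength ρ N),
          (∀ X, Φ.ψ X = (‖Φ.ψ X‖ : ℂ)) → (∀ X, Φ.ψ X ≠ 0) →
          periodicEnergy (truncPotential v n) Φ ≠ ⊤ →
          (∀ Ψ : PeriodicTrialState N (sideLength ρ N), periodicEnergy (truncPotential v n) Ψ ≠ ⊤ →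
            (periodicEnergy (truncPotential v n) Φ).toReal + s * cosMean (sideLength ρ N) k Φ ≤
              (periodicEnergy (truncPotential v n) Ψ).toReal + s * cosMean (sideLength ρ N) k Ψ) →
          hMinusOneSqW (sideLength ρ N) (fun X => ‖Φ.ψ X‖)
              (fun X => forceWave (sideLength ρ N) k Φ X -
                ∫ Y in cellN N (sideLength ρ N), forceWave (sideLength ρ N) k Φ Y * ‖Φ.ψ Y‖ ^ 2)
            ≤ ENNReal.ofReal (K * N)

/-- **S6 `FreeSquare`** — the free completed square: for EVERY `v ≥ 0`, `L > 0`, `k ≠ 0`, `t` and every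
finite-energy periodic trial state, `−N t²/|p|² ≤ ⟨Ψ, HΨ⟩ + t⟨∑ⱼcos(p·xⱼ)⟩_Ψ`. Proof (M): per particle `j`,
`cos(p·xⱼ) = |p|⁻¹ p̂·∇ⱼ sin(p·xⱼ)` (needs `k ≠ 0`, Disproof §B), integrate by parts on the cell against the
`C¹` periodic `|Ψ|²`, `|p̂·∇ⱼ|Ψ|²| ≤ 2|Ψ||∂_{j,p̂}Ψ|`, Cauchy–Schwarz and `2ab ≤ a² + b²`:
`t∫cos(p·xⱼ)|Ψ|² ≥ −∫|∂_{j,p̂}Ψ|² − (t²/|p|²)∫|Ψ|²`; sum over `j`, drop `v ≥ 0` and the transverse kinetic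
energy. This is the crux at `v = 0` with `C = 1` (gen-1 Disproof `free_response_bound`; evidence FreeSRB.lean
`free_static_response` on the item — a sorry-free proof of exactly this inequality at `v = 0` whose IBP +
square is `v`-independent; Disproof §C: `C ≥ 1/2` is necessary) and the `Q ≡ 0` case of the lever for ALL
`t`. In the composition it settles the UV branch for `|t| ≥ |p|√(E₀/(C₁N))`, which is what confines S5 to
WEAK modulations. Leans on: `kineticDensity`, `periodicEnergy`, `integral_cellN_pderiv_eq_zero`
(LangevinGenerator), `Negative.integral_norm_sq_eq_one`, `Negative.abs_cosMean_le`; evidence FreeSRB.lean. -/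
def FreeSquare : Prop :=
  ∀ (v : ℝ → ℝ≥0∞) (N : ℕ) (L : ℝ), 0 < L → ∀ (k : Fin 3 → ℤ), k ≠ 0 →
    ∀ (t : ℝ) (Ψ : PeriodicTrialState N L), periodicEnergy v Ψ ≠ ⊤ →
      -((N : ℝ) * t ^ 2 / psq L k) ≤ (periodicEnergy v Ψ).toReal + t * cosMean L k Ψ

/-- **What this line DELIVERS** (modulo S2–S6, see `kineticBranch_of`): the crux's inner inequality on the
KINETIC (ultraviolet) branch `|p|² > M₀²ρa` for SOME window parameter `M₀`, all `N ≥ 1`, `k ≠ 0`, `t`,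
finite-energy `Ψ` — VERBATIM the unclaimed interface stub `StaticResponseBoundKinetic` (with `KineticBody`
inlined) of the sibling skeleton `Lines/stable-fraction-square-completion.lean`. -/
def KineticBranch : Prop :=
  ∀ v : ℝ → ℝ≥0∞, IsRepulsiveFiniteRange v →
    ∃ M₀ : ℝ, 0 < M₀ ∧ ∃ ρ₀ : ℝ, 0 < ρ₀ ∧ ∃ C : ℝ, 0 < C ∧
      ∀ ρ : ℝ, 0 < ρ → ρ < ρ₀ → ∀ N : ℕ, 0 < N → ∀ k : Fin 3 → ℤ, k ≠ 0 →
        M₀ ^ 2 * (ρ * (scatteringLength v).toReal) < psq (sideLength ρ N) k →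
        ∀ t : ℝ, ∀ Ψ : PeriodicTrialState N (sideLength ρ N), periodicEnergy v Ψ ≠ ⊤ →
          Ineq v C ρ N k t Ψ

/-! ### The REGISTERED stubs (skeleton v3, reshape 2)

Each stub is registered with its statement WRITTEN OUT in tree vocabulary (the `def`s above are
definitionally equal abbreviations used by the glue; `forceWave`/`khat` are unfolded in S5), so that a
stub file under `Theorems/` can state exactly the registered text without importing this work file.
Open after reshape 2: S1 `stub_infraredHalf` (IR crux half), `stub_maxFormBound` (classical, for S2),
`stub_modulatedMinimiserExists` (classical, for S3), S5 `stub_uvForceWaveBound` (UV crux half).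
Closed: S4 `stub_thomsonReduction` (p74247), S6 `stub_freeSquare` (p73757), S2|MaxFormBound, S3|F1 (landed
reductions). -/

/-- S1 (delegated, XL): the infrared half — verbatim `InfraredHalf`. -/
theorem stub_infraredHalf :
    ∀ v : ℝ → ℝ≥0∞, IsRepulsiveFiniteRange v → ∀ M₀ : ℝ, 0 < M₀ →
      ∃ ρ₀ : ℝ, 0 < ρ₀ ∧ ∃ C : ℝ, 0 < C ∧
        ∀ ρ : ℝ, 0 < ρ → ρ < ρ₀ → ∀ N : ℕ, 0 < N → ∀ k : Fin 3 → ℤ, k ≠ 0 →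
          psq (sideLength ρ N) k ≤ M₀ ^ 2 * (ρ * (scatteringLength v).toReal) →
          ∀ t : ℝ, ∀ Ψ : PeriodicTrialState N (sideLength ρ N), periodicEnergy v Ψ ≠ ⊤ →
            Ineq v C ρ N k t Ψ := by
  sorry

/-- **(MaxFormBound) registered stub `stub_maxFormBound`** — the one classical fact S2 still needs
(reshape 2): for every admissible `v`, `N`, `L > 0` and every unit vector `η ∈ L²((ℝ/ℤ)^{3N})` that is
Bose-symmetric in momentum space, the `C¹`-core ground-state energy `periodicGroundStateEnergy v N L` is
bounded by the MAXIMAL-form energy of `η` (spectral kinetic energy + `∫ (W ∘ fromUnitTorusN)|η|²`, in `[0,∞]`,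
hard cores included): the Bose-symmetric periodic `C¹` core realises the infimum of the maximal hard-core
form (no Lavrentiev gap). Verbatim the hypothesis `hcore` of the landed reduction
`truncationLimit_of_maxFormBound` (`Theorems/…TruncationCompactness.lean`). True on paper (ray-wise vanishing at
the non-`L¹_loc` radii, Hardy cut-offs at the hard spheres, truncation + symmetric torus mollification); needs
form-core / trace / Hardy infrastructure absent from Mathlib. Size L (infrastructure), NOT crux-sized.
[cite: B. Simon, J. Operator Theory 1 (1979) 37; Adams–Hedberg Thm 9.1.3] -/
theorem stub_maxFormBound :
    ∀ v : ℝ → ℝ≥0∞, IsRepulsiveFiniteRange v → ∀ (N : ℕ) (L : ℝ), 0 < L →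
      ∀ η : Lp ℂ 2 (volume : Measure (UnitAddTorus (Fin N × Fin 3))), ‖η‖ = 1 →
        (∀ (σ : Equiv.Perm (Fin N)) (n : Fin N × Fin 3 → ℤ),
          ⟪(mFourierLp 2 (fun p : Fin N × Fin 3 => n (σ p.1, p.2)) :
              Lp ℂ 2 (volume : Measure (UnitAddTorus (Fin N × Fin 3)))), η⟫_ℂ =
            ⟪(mFourierLp 2 n : Lp ℂ 2 (volume : Measure (UnitAddTorus (Fin N × Fin 3)))), η⟫_ℂ) →
        periodicGroundStateEnergy v N L ≤
          ∑' n : Fin N × Fin 3 → ℤ, ENNReal.ofReal (∑ p, (2 * Real.pi * (n p : ℝ) / L) ^ 2) *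
              (‖⟪(mFourierLp 2 n : Lp ℂ 2 (volume : Measure (UnitAddTorus (Fin N × Fin 3)))), η⟫_ℂ‖₊ :
                ℝ≥0∞) ^ 2 +
            ∫⁻ t, periodicInteraction v L (fromUnitTorusN L t) *
              (‖(η : UnitAddTorus (Fin N × Fin 3) → ℂ) t‖₊ : ℝ≥0∞) ^ 2 := by
  sorry

/-- S2 `TruncationLimit` is now a THEOREM modulo `stub_maxFormBound`: the landed reduction
`truncationLimit_of_maxFormBound` (per-state Beppo Levi, compactness via the tree's Rellich
`PeriodicFormDomain.isCompactOperator_formEmbed`, Fatou, monotone limits). [folklore] -/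
theorem truncationLimit_holds : TruncationLimit :=
  truncationLimit_of_maxFormBound stub_maxFormBound

/-- **(F1) registered stub `stub_modulatedMinimiserExists`** — the one classical fact S3 still needs
(reshape 2): for a BOUNDED admissible `w`, `N ≥ 1`, `L > 0`, `k ≠ 0` and every coupling `s` there is a
positive real finite-energy periodic `C¹` trial state minimising `E_w + s·⟨∑cos⟩` among finite-energy states
(Perron–Frobenius for `−Δ + W + sV_p` on the flat torus with `W + sV_p ∈ L^∞`: compact resolvent,
positivity-improving semigroup ⇒ simple eigenvalue with a strictly positive eigenfunction, Bose-symmetric by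
uniqueness; `W^{2,p} ⊂ C^{1,α}` regularity makes it a `PeriodicTrialState`). Verbatim the hypothesis of the
landed `stub_modulationBootstrap_of_exists` (`Theorems/…ModulationBootstrapOfExists.lean`). The tree's unproved
named fact `PeriodicGroundStateFeynmanKac` is the unmodulated, merely-continuous version. Size L–XL
(infrastructure), NOT crux-sized. Recommended route (lead's crux NOTES.md): extend the tree's periodic Feynman–Kac
programme (`pfkL2_perronFrobenius`) by the bounded one-body term and get `C¹` from Duhamel + the Gaussian gradient
bound, not from Calderón–Zygmund. [cite: ReedSimonIV1978, Thm XIII.47; ChungZhao1995, Thm 3.10] -/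
theorem stub_modulatedMinimiserExists :
    ∀ w : ℝ → ℝ≥0∞, IsRepulsiveFiniteRange w → (∃ M : ℝ≥0∞, M ≠ ⊤ ∧ ∀ r, w r ≤ M) →
      ∀ (N : ℕ), 1 ≤ N → ∀ (L : ℝ), 0 < L → ∀ (k : Fin 3 → ℤ), k ≠ 0 → ∀ s : ℝ,
      ∃ Φ : PeriodicTrialState N L, (∀ X, Φ.ψ X = (‖Φ.ψ X‖ : ℂ)) ∧ (∀ X, Φ.ψ X ≠ 0) ∧
        periodicEnergy w Φ ≠ ⊤ ∧
        ∀ Ψ : PeriodicTrialState N L, periodicEnergy w Ψ ≠ ⊤ →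
          (periodicEnergy w Φ).toReal + s * cosMean L k Φ ≤
            (periodicEnergy w Ψ).toReal + s * cosMean L k Ψ := by
  sorry

/-- S3 `ModulationBootstrap` is now a THEOREM modulo `stub_modulatedMinimiserExists`: the landed Kato-free
bridge `stub_modulationBootstrap_of_exists` (weak Euler–Lagrange from minimality, ground-state representation,
exact two-point identity, Kipnis–Varadhan at both couplings, one Poincaré constant at the base point, Dini
lemma, half-wavelength translate). [cite: Kato1966, VII §3] -/
theorem modulationBootstrap_holds : ModulationBootstrap :=
  stub_modulationBootstrap_of_exists stub_modulatedMinimiserExists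

-- S4 `stub_thomsonReduction` is CLOSED: landed as
-- `Summit.AtomisticToContinuum.BoseEinsteinCondensation.Cruxes.StaticResponseBound.UvThomsonForceWave.stub_thomsonReduction`
-- in `Theorems/BECInsertionCorrectorStaticResponseBoundThomsonReduction.lean` (p74247, imported above).

/-- S5 (XL, THE HEART, hardest): UV force-wave bound for weakly modulated ground states — verbatim
`UvForceWaveBound` with `forceWave`/`khat` unfolded. -/
theorem stub_uvForceWaveBound :
    ∀ v : ℝ → ℝ≥0∞, IsRepulsiveFiniteRange v →
      ∃ Λ : ℝ, 1 ≤ Λ ∧ ∃ ρ₁ : ℝ, 0 < ρ₁ ∧ ∃ K : ℝ, 0 ≤ K ∧ ∃ n₀ : ℕ, ∀ n : ℕ, n₀ ≤ n →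
        ∀ ρ : ℝ, 0 < ρ → ρ < ρ₁ → ∀ N : ℕ, 1 ≤ N → ∀ k : Fin 3 → ℤ, k ≠ 0 →
          Λ * (ρ * (scatteringLength v).toReal) ≤ psq (sideLength ρ N) k →
          ∀ s : ℝ, s ^ 2 ≤ psq (sideLength ρ N) k *
              (periodicGroundStateEnergy (truncPotential v n) N (sideLength ρ N)).toReal / N →
          ∀ Φ : PeriodicTrialState N (sideLength ρ N),
            (∀ X, Φ.ψ X = (‖Φ.ψ X‖ : ℂ)) → (∀ X, Φ.ψ X ≠ 0) →
            periodicEnergy (truncPotential v n) Φ ≠ ⊤ →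
            (∀ Ψ : PeriodicTrialState N (sideLength ρ N), periodicEnergy (truncPotential v n) Ψ ≠ ⊤ →
              (periodicEnergy (truncPotential v n) Φ).toReal + s * cosMean (sideLength ρ N) k Φ ≤
                (periodicEnergy (truncPotential v n) Ψ).toReal + s * cosMean (sideLength ρ N) k Ψ) →
            hMinusOneSqW (sideLength ρ N) (fun X => ‖Φ.ψ X‖)
                (fun X => ((∑ j : Fin N, Real.sin (2 * Real.pi / sideLength ρ N * ∑ i, (k i : ℝ) * X j i) *
              ∑ i : Fin 3, ((k i : ℝ) / Real.sqrt (∑ l, (k l : ℝ) ^ 2)) *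
                pderiv j i (fun Y => ‖Φ.ψ Y‖ ^ 2) X) / ‖Φ.ψ X‖ ^ 2) -
                  ∫ Y in cellN N (sideLength ρ N), ((∑ j : Fin N, Real.sin (2 * Real.pi / sideLength ρ N * ∑ i, (k i : ℝ) * Y j i) *
              ∑ i : Fin 3, ((k i : ℝ) / Real.sqrt (∑ l, (k l : ℝ) ^ 2)) *
                pderiv j i (fun Y => ‖Φ.ψ Y‖ ^ 2) Y) / ‖Φ.ψ Y‖ ^ 2) * ‖Φ.ψ Y‖ ^ 2)
              ≤ ENNReal.ofReal (K * N) := by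
  sorry

-- S6 `stub_freeSquare` is CLOSED: landed as
-- `Summit.AtomisticToContinuum.BoseEinsteinCondensation.Cruxes.StaticResponseBound.UvThomsonForceWave.stub_freeSquare`
-- in `Theorems/BECInsertionCorrectorStaticResponseBoundFreeSquare.lean` (p73757, imported above).

/-! ## Small proved helpers for the composition -/

/-- `|p|² > 0` for `k ≠ 0`, `L ≠ 0`. [folklore] -/
theorem psq_pos {L : ℝ} (hL : L ≠ 0) {k : Fin 3 → ℤ} (hk : k ≠ 0) : 0 < psq L k := by
  unfold psq
  have h1 : 0 < (2 * Real.pi / L) ^ 2 := by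
    have : 2 * Real.pi / L ≠ 0 := div_ne_zero (by positivity) hL
    positivity
  have h2 : 0 < ∑ i, (k i : ℝ) ^ 2 := by
    obtain ⟨i, hi⟩ : ∃ i, k i ≠ 0 := by
      by_contra h
      push Not at h
      exact hk (funext h)
    have hi' : (0 : ℝ) < (k i : ℝ) ^ 2 := by
      have : (k i : ℝ) ≠ 0 := by exact_mod_cast hi
      positivity
    exact lt_of_lt_of_le hi'
      (Finset.single_le_sum (f := fun l => (k l : ℝ) ^ 2) (fun l _ => sq_nonneg _) (Finset.mem_univ i))
  exact mul_pos h1 h2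

/-- The truncation `v_n = min(v, n)` of an admissible potential is admissible (same range). [folklore] -/
theorem isRepulsiveFiniteRange_truncPotential {v : ℝ → ℝ≥0∞} (hv : IsRepulsiveFiniteRange v) (n : ℕ) :
    IsRepulsiveFiniteRange (truncPotential v n) := by
  refine ⟨measurable_truncPotential hv.1 n, ?_⟩
  obtain ⟨R₀, hR₀⟩ := hv.2
  exact ⟨R₀, fun r hr => truncPotential_eq_zero (hR₀ r hr) n⟩

/-- The truncation is bounded (by `n < ⊤`). [folklore] -/
theorem truncPotential_bounded (v : ℝ → ℝ≥0∞) (n : ℕ) :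
    ∃ M : ℝ≥0∞, M ≠ ⊤ ∧ ∀ r, truncPotential v n r ≤ M :=
  ⟨n, ENNReal.natCast_ne_top n, fun r => truncPotential_le_nat v n r⟩

/-- Monotonicity of the periodic energy under truncation of the potential. [folklore] -/
theorem periodicEnergy_truncPotential_le (v : ℝ → ℝ≥0∞) (n : ℕ) {N : ℕ} {L : ℝ}
    (Ψ : PeriodicTrialState N L) : periodicEnergy (truncPotential v n) Ψ ≤ periodicEnergy v Ψ := by
  unfold periodicEnergy
  refine lintegral_mono fun X => ?_
  refine add_le_add le_rfl (mul_le_mul_left ?_ _)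
  unfold periodicInteraction
  refine Finset.sum_le_sum fun i _ => Finset.sum_le_sum fun j _ => ?_
  unfold periodizedPotential
  exact ENNReal.tsum_le_tsum fun m => truncPotential_le v n _

/-- `(√N + √(K N))² = (1 + √K)² N`. [folklore] -/
theorem sqrt_add_sqrt_mul_sq {K : ℝ} (hK : 0 ≤ K) (N : ℕ) :
    (Real.sqrt N + Real.sqrt (K * N)) ^ 2 = (1 + Real.sqrt K) ^ 2 * N := by
  have hN : (0 : ℝ) ≤ N := Nat.cast_nonneg N
  rw [Real.sqrt_mul' K hN]
  have hsN : Real.sqrt N ^ 2 = N := Real.sq_sqrt hN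
  calc (Real.sqrt N + Real.sqrt K * Real.sqrt N) ^ 2
      = (1 + Real.sqrt K) ^ 2 * Real.sqrt N ^ 2 := by ring
    _ = (1 + Real.sqrt K) ^ 2 * N := by rw [hsN]

/-- Monotonicity of the crux's inner inequality in the constant (a larger `C` only weakens it).
[folklore; same lemma as in the sibling skeleton] -/
theorem ineq_mono_C {v : ℝ → ℝ≥0∞} {C C' ρ : ℝ} {N : ℕ} {k : Fin 3 → ℤ} {t : ℝ}
    {Ψ : PeriodicTrialState N (sideLength ρ N)} (h : Ineq v C ρ N k t Ψ) (hCC' : C ≤ C') :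
    Ineq v C' ρ N k t Ψ := by
  unfold Ineq at h ⊢
  have hmax : 0 ≤ max (ρ * (scatteringLength v).toReal) (psq (sideLength ρ N) k) :=
    le_max_of_le_right (psq_nonneg _ _)
  have hle : C * t ^ 2 * N / max (ρ * (scatteringLength v).toReal) (psq (sideLength ρ N) k) ≤
      C' * t ^ 2 * N / max (ρ * (scatteringLength v).toReal) (psq (sideLength ρ N) k) := by
    apply div_le_div_of_nonneg_right _ hmax
    have : (0 : ℝ) ≤ t ^ 2 * N := by positivity
    nlinarith
  linarith

/-! ## The compositions (kernel-checked, no `sorry` of their own) -/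

/-- **The UV half from S2–S6**: `TruncationLimit → ModulationBootstrap → ThomsonReduction →
UvForceWaveBound → FreeSquare → KineticBranch` — the sibling skeleton's unclaimed interface stub
`StaticResponseBoundKinetic`, with `M₀ = √Λ`, `ρ₀ = ρ₁`, `C = C₁ + 1`, `C₁ = (1 + √K)²`.
For `N ≥ 1`, `k ≠ 0` in the window `Λρa ≤ |p|²` (`max(ρa,|p|²) = |p|²`): if `|p|²·E₀ ≤ C₁N t²` the free
square S6 already gives `E₀ − (C₁+1)t²N/|p|² ≤ −Nt²/|p|² ≤ E_Ψ + t⟨∑cos⟩`; otherwise `N t² < |p|²·E₀(v)`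
with room `δ`, so by S2 `t² ≤ |p|²·E₀(v_n)/N` for `n` large, every weakly modulated ground state of `v_n`
has force wave `≤ K N` in `H₋₁` (S5), hence susceptibility `≤ C₁N/|p|²` (S4), hence
`E₀(v_n) − (C₁N/|p|²)t² ≤ E_{v_n}(Ψ) + t⟨∑cos⟩` (S3) `≤ E_v(Ψ) + t⟨∑cos⟩`, and `E₀(v_n) → E₀(v)` (S2). -/
theorem kineticBranch_of (h₂ : TruncationLimit) (h₃ : ModulationBootstrap) (h₄ : ThomsonReduction)
    (h₅ : UvForceWaveBound) (h₆ : FreeSquare) : KineticBranch := by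
  intro v hv
  obtain ⟨Λ, hΛ, ρ₁, hρ₁, K, hK, n₀, hUV⟩ := h₅ v hv
  have hΛpos : 0 < Λ := lt_of_lt_of_le one_pos hΛ
  have hsK : 0 ≤ Real.sqrt K := Real.sqrt_nonneg K
  have hC₁ : 1 ≤ (1 + Real.sqrt K) ^ 2 := by nlinarith
  refine ⟨Real.sqrt Λ, Real.sqrt_pos.mpr hΛpos, ρ₁, hρ₁, (1 + Real.sqrt K) ^ 2 + 1, by linarith, ?_⟩
  intro ρ hρ hρ1 N hNpos k hk hwin t Ψ hΨ
  rw [Real.sq_sqrt hΛpos.le] at hwin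
  have hUVcase : Λ * (ρ * (scatteringLength v).toReal) ≤ psq (sideLength ρ N) k := hwin.le
  have hN1 : 1 ≤ N := hNpos
  have hNR : (0 : ℝ) < N := by exact_mod_cast hNpos
  have hL : 0 < sideLength ρ N := sideLength_pos hρ hNpos
  have hP : 0 < psq (sideLength ρ N) k := psq_pos hL.ne' hk
  have ha : 0 ≤ ρ * (scatteringLength v).toReal := mul_nonneg hρ.le ENNReal.toReal_nonneg
  have hΛρa : ρ * (scatteringLength v).toReal ≤ Λ * (ρ * (scatteringLength v).toReal) :=
    le_mul_of_one_le_left ha hΛ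
  unfold Ineq
  -- ultraviolet window: `max = |p|²`
  have hmax : max (ρ * (scatteringLength v).toReal) (psq (sideLength ρ N) k) = psq (sideLength ρ N) k :=
    max_eq_right (hΛρa.trans hUVcase)
  rw [hmax]
  have hfree := h₆ v N (sideLength ρ N) hL k hk t Ψ hΨ
  have hE0nn : 0 ≤ (periodicGroundStateEnergy v N (sideLength ρ N)).toReal := ENNReal.toReal_nonneg
  have hsplit : ((1 + Real.sqrt K) ^ 2 + 1) * t ^ 2 * N / psq (sideLength ρ N) k =
      (1 + Real.sqrt K) ^ 2 * t ^ 2 * N / psq (sideLength ρ N) k +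
        (N : ℝ) * t ^ 2 / psq (sideLength ρ N) k := by
    ring
  rcases le_or_gt (psq (sideLength ρ N) k * (periodicGroundStateEnergy v N (sideLength ρ N)).toReal)
      ((1 + Real.sqrt K) ^ 2 * N * t ^ 2) with hA | hB
  · -- large coupling: the free square
    have hE0le : (periodicGroundStateEnergy v N (sideLength ρ N)).toReal ≤
        (1 + Real.sqrt K) ^ 2 * t ^ 2 * N / psq (sideLength ρ N) k := by
      rw [le_div_iff₀ hP]
      linarith
    linarith
  · -- small coupling: bootstrap through the truncations
    have hE0fin : periodicGroundStateEnergy v N (sideLength ρ N) ≠ ⊤ :=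
      ne_top_of_le_ne_top hΨ (periodicGroundStateEnergy_le v Ψ)
    -- room in the window
    set δ : ℝ := psq (sideLength ρ N) k * (periodicGroundStateEnergy v N (sideLength ρ N)).toReal -
      (N : ℝ) * t ^ 2 with hδ
    have hδpos : 0 < δ := by
      have : (N : ℝ) * t ^ 2 ≤ (1 + Real.sqrt K) ^ 2 * N * t ^ 2 := by
        have h0 : 0 ≤ (N : ℝ) * t ^ 2 := by positivity
        nlinarith
      rw [hδ]
      linarith
    -- the core inequality with the constant `C₁`, up to an arbitrary `ε > 0`
    have hcore : ∀ ε : ℝ, 0 < ε →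
        (periodicGroundStateEnergy v N (sideLength ρ N)).toReal -
            (1 + Real.sqrt K) ^ 2 * t ^ 2 * N / psq (sideLength ρ N) k ≤
          (periodicEnergy v Ψ).toReal + t * cosMean (sideLength ρ N) k Ψ + ε := by
      intro ε hε
      -- truncation height: large enough for S5 and for the S2-error `min ε (δ/|p|²)`
      have hε' : 0 < min ε (δ / psq (sideLength ρ N) k) := lt_min hε (div_pos hδpos hP)
      obtain ⟨n₁, hn₁⟩ := h₂ v hv N (sideLength ρ N) hL hE0fin _ hε'
      set n := max n₀ n₁ with hn
      have hn0 : n₀ ≤ n := le_max_left _ _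
      have hnn1 : n₁ ≤ n := le_max_right _ _
      have hS2 := hn₁ n hnn1
      have hminε : min ε (δ / psq (sideLength ρ N) k) ≤ ε := min_le_left _ _
      have hminδ : min ε (δ / psq (sideLength ρ N) k) ≤ δ / psq (sideLength ρ N) k := min_le_right _ _
      -- the window of S5 / S3 for the truncated problem contains `t`
      have hwin' : t ^ 2 ≤ psq (sideLength ρ N) k *
          (periodicGroundStateEnergy (truncPotential v n) N (sideLength ρ N)).toReal / N := by
        rw [le_div_iff₀ hNR]
        have h1 : psq (sideLength ρ N) k * (δ / psq (sideLength ρ N) k) = δ := by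
          field_simp
        have h2 : psq (sideLength ρ N) k * (periodicGroundStateEnergy v N (sideLength ρ N)).toReal ≤
            psq (sideLength ρ N) k *
                (periodicGroundStateEnergy (truncPotential v n) N (sideLength ρ N)).toReal +
              psq (sideLength ρ N) k * (δ / psq (sideLength ρ N) k) := by
          have := mul_le_mul_of_nonneg_left (hS2.trans (add_le_add le_rfl hminδ)) hP.le
          linarith [this]
        rw [h1, hδ] at h2
        linarith
      -- S5 → S4: susceptibility of every weakly modulated ground state of `v_n`
      have hχ : ∀ s : ℝ, s ^ 2 ≤ psq (sideLength ρ N) k *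
            (periodicGroundStateEnergy (truncPotential v n) N (sideLength ρ N)).toReal / N →
          ∀ Φ : PeriodicTrialState N (sideLength ρ N),
            (∀ X, Φ.ψ X = (‖Φ.ψ X‖ : ℂ)) → (∀ X, Φ.ψ X ≠ 0) →
            periodicEnergy (truncPotential v n) Φ ≠ ⊤ →
            (∀ Ψ' : PeriodicTrialState N (sideLength ρ N), periodicEnergy (truncPotential v n) Ψ' ≠ ⊤ →
              (periodicEnergy (truncPotential v n) Φ).toReal + s * cosMean (sideLength ρ N) k Φ ≤
                (periodicEnergy (truncPotential v n) Ψ').toReal + s * cosMean (sideLength ρ N) k Ψ') →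
            hMinusOneSqW (sideLength ρ N) (fun X => ‖Φ.ψ X‖)
                (fun X => (∑ j, Real.cos (2 * Real.pi / sideLength ρ N * ∑ i, (k i : ℝ) * X j i)) -
                  cosMean (sideLength ρ N) k Φ)
              ≤ ENNReal.ofReal ((1 + Real.sqrt K) ^ 2 * N / psq (sideLength ρ N) k) := by
        intro s hs Φ hreal hpos hfinΦ hmin
        have hQ := hUV n hn0 ρ hρ hρ1 N hN1 k hk hUVcase s hs Φ hreal hpos hfinΦ hmin
        have hT := h₄ N (sideLength ρ N) hL k hk Φ (K * N) (by positivity) hQ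
        rwa [sqrt_add_sqrt_mul_sq hK N] at hT
      -- S3 on the truncated (bounded) problem
      have hΨn : periodicEnergy (truncPotential v n) Ψ ≠ ⊤ :=
        ne_top_of_le_ne_top hΨ (periodicEnergy_truncPotential_le v n Ψ)
      have hboot := h₃ (truncPotential v n) (isRepulsiveFiniteRange_truncPotential hv n)
        (truncPotential_bounded v n) N hN1 (sideLength ρ N) hL k hk
        (psq (sideLength ρ N) k *
          (periodicGroundStateEnergy (truncPotential v n) N (sideLength ρ N)).toReal / N)
        ((1 + Real.sqrt K) ^ 2 * N / psq (sideLength ρ N) k)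
        (by positivity) (by positivity) hχ t hwin' Ψ hΨn
      -- transfer energies from `v_n` to `v`
      have hEΨ : (periodicEnergy (truncPotential v n) Ψ).toReal ≤ (periodicEnergy v Ψ).toReal :=
        ENNReal.toReal_mono hΨ (periodicEnergy_truncPotential_le v n Ψ)
      have hconst : (1 + Real.sqrt K) ^ 2 * N / psq (sideLength ρ N) k * t ^ 2 =
          (1 + Real.sqrt K) ^ 2 * t ^ 2 * N / psq (sideLength ρ N) k := by
        field_simp
      rw [hconst] at hboot
      linarith
    have hfinal : (periodicGroundStateEnergy v N (sideLength ρ N)).toReal -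
          (1 + Real.sqrt K) ^ 2 * t ^ 2 * N / psq (sideLength ρ N) k ≤
        (periodicEnergy v Ψ).toReal + t * cosMean (sideLength ρ N) k Ψ :=
      le_of_forall_pos_le_add hcore
    have hextra : 0 ≤ (N : ℝ) * t ^ 2 / psq (sideLength ρ N) k := by positivity
    linarith

/-- **The crux's unbundled body from the six stub statements** (explicit hypotheses; kernel-checked,
axioms `propext`/`Classical.choice`/`Quot.sound` only — `#print axioms body_of_stubs`). Given `v`:
`kineticBranch_of` supplies `(M₀, ρ₁, C₁)`, S1 at window `M₀` supplies `(ρ₂, C₂)`; take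
`ρ₀ = min(ρ₁, ρ₂)`, `C = max(C₁, C₂)`; `N = 0` is `Negative.ineq_N_zero`; for `N ≥ 1` split on
`|p|² ≤ M₀²ρa` and weaken the constant (`ineq_mono_C`). -/
theorem body_of_stubs (h₁ : InfraredHalf) (h₂ : TruncationLimit) (h₃ : ModulationBootstrap)
    (h₄ : ThomsonReduction) (h₅ : UvForceWaveBound) (h₆ : FreeSquare) :
    ∀ v : ℝ → ℝ≥0∞, IsRepulsiveFiniteRange v → ∃ ρ₀ : ℝ, 0 < ρ₀ ∧ ∃ C : ℝ, 0 < C ∧ Body v ρ₀ C := by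
  intro v hv
  obtain ⟨M₀, hM₀, ρ₁, hρ₁, C₁, hC₁, hKin⟩ := kineticBranch_of h₂ h₃ h₄ h₅ h₆ v hv
  obtain ⟨ρ₂, hρ₂, C₂, hC₂, hPh⟩ := h₁ v hv M₀ hM₀
  refine ⟨min ρ₁ ρ₂, lt_min hρ₁ hρ₂, max C₁ C₂, lt_of_lt_of_le hC₁ (le_max_left _ _), ?_⟩
  intro ρ hρ hρlt N k hk t Ψ hΨ
  rcases Nat.eq_zero_or_pos N with hN | hN
  · subst hN
    exact ineq_N_zero v _ ρ k t Ψ hΨ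
  · rcases le_or_gt (psq (sideLength ρ N) k) (M₀ ^ 2 * (ρ * (scatteringLength v).toReal)) with hle | hlt
    · exact ineq_mono_C (hPh ρ hρ (lt_of_lt_of_le hρlt (min_le_right _ _)) N hN k hk hle t Ψ hΨ)
        (le_max_right _ _)
    · exact ineq_mono_C (hKin ρ hρ (lt_of_lt_of_le hρlt (min_le_left _ _)) N hN k hk hlt t Ψ hΨ)
        (le_max_left _ _)

/-- **`StaticResponseBound` from the line `uv-thomson-force-wave`**: the crux BY NAME, as
`staticResponseBound_iff.mpr (body_of_stubs stub₁ … stub₆)` — the only `sorry`s in its cone are the six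
registered stubs. -/
theorem StaticResponseBound_of : StaticResponseBound :=
  staticResponseBound_iff.mpr
    (body_of_stubs stub_infraredHalf truncationLimit_holds modulationBootstrap_holds stub_thomsonReduction
      stub_uvForceWaveBound stub_freeSquare)

end Summit.AtomisticToContinuum.BoseEinsteinCondensation.Cruxes.StaticResponseBound.UvThomsonForceWave

end
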